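/-
Copyright (c) 2026 the pub-hodgecm-mathlib formalisation cell (harness21).  Prover seat hodgecm-mathlib-K2Liu-p01 (g10), Track B «K2-LIT»,
#184♮ = hLiu418 = `stmt-HodgeConjecture-24832`; #42S organ S1 ROAD W, THE DYADIC ROAD (LEAD F0P6-plan (g14) OWNER WORD σ22 (D2)(a) 2026-09-04T15:35:36Z),
FILE A: ★ (ii) `K2LiuInertHyperbolicFrame` WITHOUT the non-dyadic letter `h2` — the hyperbolic frame of `diag(d₀, d₁, d₂)` over `E_{w₀}` at EVERY inert
unramified place, dyadic places included.
-/
import Summits.HodgeConjecture.HodgeConjecture.Theorems.K2LiuHyperbolicFrameOfIsotropic     -- ★ (K2Liu-p10) `exists_hyperbolic_frame_of_isotropic`; ★ (ii-a) `exists_pair_even_sub`, `herm_pair_pair`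
import Literature.NumberTheory.Automorphic.UnitaryGroupInertPlaceHyperbolicBasis           -- ★ `exists_mul_galAdicCompletionMap_eq_of_isUnramifiedIn` (σ-fixed units are norms, all residue characteristics), `galAdicCompletionMap_galAdicCompletionMap_of_smul_eq`
import HarnessLib

/-!
# Crux `HLiu418`, #42S-S1 ROAD W, THE DYADIC ROAD, FILE A: THE HYPERBOLIC FRAME OF `diag(d₀, d₁, d₂)` OVER `E_{w₀}` AT AN INERT UNRAMIFIED PLACE — DYADIC INCLUDED

Cell `hodgecm-mathlib`, crux item hLiu418 = `stmt-HodgeConjecture-24832` (helper lane `--supports … --as helper`, count-neutral).  THEOREMS ONLY (no `def`, no instance,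
no notation, no named-fact hypothesis, no `sorry`).  Generic quadratic extension `E/F` with `c`, inert unramified `w₀ ∣ v` (`hc hw₀ hv`; NO condition on the residue
characteristic), `K = E_{w₀}`, `σ = σ_{w₀} = galAdicCompletionMap c hw₀`.

WHY.  In the ★ inert S1 witness chain ((W2-a)…(W2-g), (γ1), (iii-b), (K-tot), (W1-a)(W1-b)(W1-d), (P1) ED. 3 = ★ (H4) `K2LiuInertWitnessPackageOfMover`, (H1), (H2)) the letter
`h2 : (2 : 𝓞 F) ∉ v` is load-bearing in exactly one place: ★ (ii) `K2LiuInertHyperbolicFrame.exists_inert_hyperbolic_frame`, which takes the local conjugation datum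
★ `localConjDatum_adicCompletion … hv h2` (a datum with `v(2) = 1`) to write the `σ`-fixed even-valuation element `−d_j∕d_i` as a norm.  This file proves the SAME
statement without `h2`, so that (H4) ED. 4 (FILE B of the dyadic road) serves the inert DYADIC places with the unchanged boxes (`e₂ = 0`, `c₀ = m_ψ + v(d)`).

THE STATEMENT (`exists_inert_hyperbolic_frame_of_isUnramifiedIn`): for `σ`-fixed non-zero `d₀, d₁, d₂ ∈ E_{w₀}` there is `P ∈ M₃(E_{w₀})` with `det P = 1` and
`P · diag(d)ᵀ · σ(P)ᵀ = [[0,1,0],[1,0,0],[0,0,−d₀d₁d₂]]` — byte-identical to ★ (ii)'s conclusion (the `(hPdet, hP)` letters of ★ (K-tot) `exists_inert_frame_homeomorph_frame`).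
PROOF.  Two of the three valuations `v(d_k) ∈ ℤ` have the same parity (★ (ii-a) `exists_pair_even_sub`), so `c = −d_j∕d_i` is `σ`-fixed of valuation `exp(−2r)`.  With a
global uniformizer `ϖ` of `w₀` (Mathlib `valuation_exists_uniformizer`) put `s = ϖ^r`: `s·σs` is `σ`-fixed of valuation `exp(−2r)` (`σ` is an isometric involution, ★
`valued_galAdicCompletionMap`, ★ `galAdicCompletionMap_galAdicCompletionMap_of_smul_eq`), hence `u = c∕(s·σs)` is a `σ`-FIXED UNIT, so `u = t·σt` by ★
`exists_mul_galAdicCompletionMap_eq_of_isUnramifiedIn` («units are norms at an unramified place», [Omeara1963, §63C 63:16], every residue characteristic), and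
`c = λ·σλ` with `λ = t·s`.  Then `u = λe_i + e_j ≠ 0` is ISOTROPIC (★ (ii-a) `herm_pair_pair`), `t₀ = ½` has `t₀ + σt₀ = 1` (characteristic `0`), and ★ (K2Liu-p10)
`exists_hyperbolic_frame_of_isotropic` gives the frame.  [Jacobowitz1962, §7 Thm. 7.1] [Omeara1963, §63C] [Scharlau1985HermitianForms, Ch. 7 §6] [Serre1979, Ch. V §2].
HONEST LABEL.  Count-neutral helper; `HC_CM` is proved only modulo the 7 printed citations (2 remaining named inputs: hLiu418 = `stmt-HodgeConjecture-24832`,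
h413 = `stmt-HodgeConjecture-24833`) until rung 0 closes.  NOT here: the coordinate iso `κ` (★ (K-tot)), the witness package ((H4) ED. 4 = FILE B).

## References
* [Jacobowitz1962] R. Jacobowitz, *Hermitian forms over local fields*, Amer. J. Math. 84 (1962), §7 Thm. 7.1 (unramified, dyadic included).
* [Omeara1963] O. T. O'Meara, *Introduction to Quadratic Forms*, Grundlehren 117 (1963), §63C Example 63:16.
* [Scharlau1985HermitianForms] W. Scharlau, *Quadratic and Hermitian Forms*, Grundlehren 270 (1985), Ch. 7 §6.
* [Serre1979] J.-P. Serre, *Local Fields*, GTM 67 (1979), Ch. V §2.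
-/

set_option autoImplicit false
set_option linter.dupNamespace false -- the mandated namespace repeats `HodgeConjecture.HodgeConjecture`

noncomputable section

open Matrix NumberField IsDedekindDomain
open scoped Valued WithZero
open Literature.NumberTheory.Automorphic Literature.NumberTheory.Automorphic.UnitaryGroup

namespace Summit.HodgeConjecture.HodgeConjecture.Cruxes.HLiu418.K2LiuInertHyperbolicFrameDyadic

open K2LiuHyperbolicPairOfIsotropicNorm K2LiuHyperbolicFrameOfIsotropic

variable {F E : Type} [Field F] [NumberField F] [Field E] [NumberField E] [Algebra F E] [Algebra.IsQuadraticExtension F E]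
  (c : E ≃ₐ[F] E) {v : HeightOneSpectrum (𝓞 F)} (w₀ : PlacesOver E v)

/-- **A `σ`-FIXED ELEMENT OF EVEN VALUATION IS A NORM `λ·σλ` AT AN INERT UNRAMIFIED PLACE — dyadic places included** (`c = (s·σs)·u` with `s = ϖ^r`, `u` a `σ`-fixed unit,
and units are norms at an unramified place). [cite: Omeara1963, §63C Example 63:16] [cite: Serre1979, Ch. V §2] -/
theorem exists_mul_galAdicCompletionMap_eq_of_valued_eq_exp_even (hc : c ≠ 1) (hw₀ : c • w₀.1 = w₀.1) (hv : Algebra.IsUnramifiedIn (𝓞 E) v.asIdeal)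
    {x : w₀.1.adicCompletion E} (hσx : galAdicCompletionMap (L := E) c hw₀ x = x) {r : ℤ} (hvx : Valued.v x = WithZero.exp (2 * r)) :
    ∃ lam : w₀.1.adicCompletion E, lam * galAdicCompletionMap (L := E) c hw₀ lam = x := by
  have hσσ : ∀ y, galAdicCompletionMap (L := E) c hw₀ (galAdicCompletionMap (L := E) c hw₀ y) = y :=
    galAdicCompletionMap_galAdicCompletionMap_of_smul_eq c w₀ hc hw₀
  -- `s = ϖ^{−r}` for a global uniformizer `ϖ` of `w₀`: `v(s) = exp(r)`
  obtain ⟨ϖ, hϖ⟩ := w₀.1.valuation_exists_uniformizer E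
  set s : w₀.1.adicCompletion E := ((ϖ : E) : w₀.1.adicCompletion E) ^ (-r) with hs_def
  have hs : Valued.v s = WithZero.exp r := by
    rw [hs_def, map_zpow₀, HeightOneSpectrum.valuedAdicCompletion_eq_valuation', hϖ, ← WithZero.exp_zsmul, smul_eq_mul, mul_neg, mul_one, neg_neg]
  -- `s·σs` is `σ`-fixed of valuation `exp(2r)`, non-zero
  have hssσ : galAdicCompletionMap (L := E) c hw₀ (s * galAdicCompletionMap (L := E) c hw₀ s) = s * galAdicCompletionMap (L := E) c hw₀ s := by
    rw [map_mul, hσσ, mul_comm]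
  have hssv : Valued.v (s * galAdicCompletionMap (L := E) c hw₀ s) = WithZero.exp (2 * r) := by
    rw [map_mul, valued_galAdicCompletionMap, hs, ← WithZero.exp_add, two_mul]
  have hss0 : s * galAdicCompletionMap (L := E) c hw₀ s ≠ 0 := fun h => by
    rw [h, map_zero] at hssv
    exact WithZero.zero_ne_coe hssv
  -- `u = x ∕ (s·σs)` is a `σ`-fixed unit, hence a norm `t·σt`
  have hu1 : Valued.v (x / (s * galAdicCompletionMap (L := E) c hw₀ s)) = 1 := by
    rw [map_div₀, hvx, hssv, div_self (WithZero.coe_ne_zero)]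
  have hufix : galAdicCompletionMap (L := E) c hw₀ (x / (s * galAdicCompletionMap (L := E) c hw₀ s)) = x / (s * galAdicCompletionMap (L := E) c hw₀ s) := by
    rw [map_div₀, hσx, hssσ]
  obtain ⟨t, -, ht⟩ := exists_mul_galAdicCompletionMap_eq_of_isUnramifiedIn c w₀ hc hw₀ hv _ hu1 hufix
  refine ⟨t * s, ?_⟩
  rw [map_mul, mul_mul_mul_comm, ht, div_mul_cancel₀ _ hss0]

/-- **THE HYPERBOLIC FRAME AT AN INERT UNRAMIFIED PLACE — DYADIC PLACES INCLUDED**: for `σ`-fixed non-zero `d₀, d₁, d₂ ∈ E_{w₀}` there is `P` with `det P = 1` and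
`P·diag(d)ᵀ·σ(P)ᵀ = [[0,1,0],[1,0,0],[0,0,−d₀d₁d₂]]` (★ (ii) `exists_inert_hyperbolic_frame` without its letter `h2`).
[cite: Jacobowitz1962, §7 Thm. 7.1] [cite: Scharlau1985HermitianForms, Ch. 7 §6] [cite: Omeara1963, §63C Example 63:16] -/
theorem exists_inert_hyperbolic_frame_of_isUnramifiedIn (hc : c ≠ 1) (hw₀ : c • w₀.1 = w₀.1) (hv : Algebra.IsUnramifiedIn (𝓞 E) v.asIdeal)
    (d : Fin 3 → w₀.1.adicCompletion E) (hσd : ∀ k, galAdicCompletionMap (L := E) c hw₀ (d k) = d k) (hd0 : ∀ k, d k ≠ 0) :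
    ∃ P : Matrix (Fin 3) (Fin 3) (w₀.1.adicCompletion E), P.det = 1 ∧
      P * (Matrix.diagonal d)ᵀ * (P.map (galAdicCompletionMap (L := E) c hw₀))ᵀ = !![0, 1, 0; 1, 0, 0; 0, 0, -(d 0 * d 1 * d 2)] := by
  haveI : CharZero (w₀.1.adicCompletion E) := charZero_of_injective_algebraMap (algebraMap E _).injective
  have hσσ : ∀ y, galAdicCompletionMap (L := E) c hw₀ (galAdicCompletionMap (L := E) c hw₀ y) = y :=
    galAdicCompletionMap_galAdicCompletionMap_of_smul_eq c w₀ hc hw₀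
  -- two of the three valuations have the same parity
  obtain ⟨i, j, hij, r, hr⟩ := exists_pair_even_sub fun k => WithZero.log (Valued.v (d k))
  -- `c = −d_j∕d_i` is `σ`-fixed of valuation `exp(2·(−r))`, hence a norm `λ·σλ`
  have hvc : Valued.v (-(d j / d i)) = WithZero.exp (2 * (-r)) := by
    have hlog : ∀ k, Valued.v (d k) = WithZero.exp (WithZero.log (Valued.v (d k))) := fun k =>
      (WithZero.exp_log ((Valuation.ne_zero_iff _).2 (hd0 k))).symm  -- ★ (ii) `valued_eq_exp_log`
    rw [Valuation.map_neg, map_div₀, hlog j, hlog i, ← WithZero.exp_sub]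
    congr 1
    omega
  have hσc : galAdicCompletionMap (L := E) c hw₀ (-(d j / d i)) = -(d j / d i) := by rw [map_neg, map_div₀, hσd, hσd]
  obtain ⟨lam, hlam⟩ := exists_mul_galAdicCompletionMap_eq_of_valued_eq_exp_even c w₀ hc hw₀ hv hσc hvc
  -- the isotropic vector `u = λ e_i + e_j`
  have huu : (∑ k, d k * ((Pi.single i lam : Fin 3 → w₀.1.adicCompletion E) + (Pi.single j 1 : Fin 3 → w₀.1.adicCompletion E)) k *
      galAdicCompletionMap (L := E) c hw₀
        (((Pi.single i lam : Fin 3 → w₀.1.adicCompletion E) + (Pi.single j 1 : Fin 3 → w₀.1.adicCompletion E)) k)) = 0 := by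
    rw [herm_pair_pair (galAdicCompletionMap (L := E) c hw₀) d hij lam 1 lam 1, map_one, mul_one, mul_one, mul_assoc, hlam, mul_neg, mul_div_cancel₀ _ (hd0 i),
      neg_add_cancel]
  have hu0 : ((Pi.single i lam : Fin 3 → w₀.1.adicCompletion E) + (Pi.single j 1 : Fin 3 → w₀.1.adicCompletion E)) ≠ 0 := by
    intro h
    have hj := congrFun h j
    rw [Pi.add_apply, Pi.single_eq_of_ne hij.symm, Pi.single_eq_same, zero_add, Pi.zero_apply] at hj
    exact one_ne_zero hj
  -- `t₀ = ½` (characteristic `0`; no integrality is asked of `t₀`)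
  have ht₀ : (2 : w₀.1.adicCompletion E)⁻¹ + galAdicCompletionMap (L := E) c hw₀ (2 : w₀.1.adicCompletion E)⁻¹ = 1 := by
    rw [map_inv₀, map_ofNat, ← two_mul, mul_inv_cancel₀ two_ne_zero]
  exact exists_hyperbolic_frame_of_isotropic (galAdicCompletionMap (L := E) c hw₀) d hσσ hσd hd0 ht₀ hu0 huu

end Summit.HodgeConjecture.HodgeConjecture.Cruxes.HLiu418.K2LiuInertHyperbolicFrameDyadic

end
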